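import Summits.CriticalPhenomena.PercolationContinuityZ3.Theorems.PercNearOneGluingNoHeavyLowerTailSunflowerSpectatorTransfer
import HarnessLib

/-!
# `NoHeavyLowerTail` (crux stmt-CriticalPhenomena-4575), abstract sunflower cubic: the PETAL-SPECTATOR CRITERION for the partition lemma —
# a numerical sufficient condition that covers almost every tested sunflower, including the doubled (co-)star

Support file (seat `prim-ineq-gen-2` gen 24; `--supports stmt-CriticalPhenomena-4575`; a three-line corollary of `…SunflowerSpectatorTransfer` (p318140:
the petal-spectator identity `3·Sw 1_{k} = 6·Nabk k − Ntri − 6·NkkForeign k`) and `…SunflowerSpectatorRows` (`ZH = 3·Sw 1_{0,⊤} − Ntri`), recorded as a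
named class theorem because of its coverage).  Memo: run/shared/lean/prim/prim-ineq-gen-2/ONE-POINT-SCAN-GEN24.md §6.  Nothing is asserted about the crux; no `sorry`.

* `Sunflower.ZH_ge_petal_spectator` — for every petal label `k`:  `ZH ≥ 3·Sw 1_{0,⊤} − 6·Nabk k + 6·NkkForeign k`  (the rainbows are paid by the
  `(kernel, bottom, C_k)` partitions: `Ntri ≤ 6·Nabk k − 6·NkkForeign k`, `Sunflower.Ntri_le_six_Nabk`).
* `Sunflower.ZH_nonneg_of_petal_spectator_criterion` — **★ (`0 ≤ ZH`) whenever some petal `k` has `6·Nabk k ≤ 3·Sw 1_{0,⊤} + 6·NkkForeign k`**, in words: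
  the number of ordered `(kernel, bottom, C_k)` partitions is at most half the total Gladkov slack of the kernel and bottom spectators plus the `(k,k,foreign)` count;
  weaker convenient form `Sunflower.ZH_nonneg_of_two_Nabk_le`.
CENSUS (gen 24, exact; memo §6): the criterion holds for EVERY sunflower with rainbows in random samples on 4–7 points (152/152), for ALL 504 six-point sunflowers
WITHOUT a good coordinate found by adversarial search (the frontier of the good-coordinate recursion, among them the doubled (co-)star: `ZH = 42`, `Ntri = 48 = 6·Nabk k`),
for `K₄`, `K₃,₃` (mixed terminals), `K₂,₄`, co-star(3,2,2), θ∘{OR,AND,MAJ₃} products; as a universal statement it is seat gen-22's (★★) and is FALSE — first failure the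
tripled star co-star(3,3,3) on 9 points (`ZH = 114 > 0` but `6·Nabk k − 6·NkkForeign k > 3·Sw 1_{0,⊤}` for all three `k`).  So the open core of ★ beyond this
criterion starts at heavily cloned structures.
-/

namespace Summit.CriticalPhenomena.PercolationContinuityZ3.Theorems.SunflowerPartition

open Finset

variable {α : Type*} [Fintype α] [DecidableEq α]

namespace Sunflower

variable (F : Sunflower α)

/-- **Petal-spectator lower bound** (this work): for every petal label `k`, `3·Sw 1_{0,⊤} − 6·Nabk k + 6·NkkForeign k ≤ ZH`. -/
theorem ZH_ge_petal_spectator (k : Fin 5) (hk0 : k ≠ 0) (hk4 : k ≠ 4) :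
    3 * F.Sw (fun v => if v = 0 ∨ v = 4 then 1 else 0) - 6 * F.Nabk k + 6 * F.NkkForeign k ≤ F.ZH := by
  have h1 := F.ZH_eq_spec
  have h2 := F.Ntri_le_six_Nabk k hk0 hk4
  linarith

/-- **The petal-spectator criterion for ★** (this work): if some petal `k` satisfies `6·Nabk k ≤ 3·Sw 1_{0,⊤} + 6·NkkForeign k`, then `0 ≤ ZH`. -/
theorem ZH_nonneg_of_petal_spectator_criterion (k : Fin 5) (hk0 : k ≠ 0) (hk4 : k ≠ 4)
    (h : 6 * F.Nabk k ≤ 3 * F.Sw (fun v => if v = 0 ∨ v = 4 then 1 else 0) + 6 * F.NkkForeign k) : 0 ≤ F.ZH := by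
  have h1 := F.ZH_ge_petal_spectator k hk0 hk4
  linarith

/-- **Convenient weaker form** (this work): `2·Nabk k ≤ Sw 1_{0,⊤}` for some petal `k` ⟹ `0 ≤ ZH`. -/
theorem ZH_nonneg_of_two_Nabk_le (k : Fin 5) (hk0 : k ≠ 0) (hk4 : k ≠ 4)
    (h : 2 * F.Nabk k ≤ F.Sw (fun v => if v = 0 ∨ v = 4 then 1 else 0)) : 0 ≤ F.ZH := by
  have h0 := F.NkkForeign_nonneg k
  exact F.ZH_nonneg_of_petal_spectator_criterion k hk0 hk4 (by linarith)

/-- **Contrapositive reading** (this work): in any counterexample to ★ every petal `k` has `3·Sw 1_{0,⊤} + 6·NkkForeign k < 6·Nabk k` —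
all three `(kernel, bottom, C_k)` counts are large compared with the kernel/bottom Gladkov slack. -/
theorem six_Nabk_gt_of_ZH_neg (hZ : F.ZH < 0) (k : Fin 5) (hk0 : k ≠ 0) (hk4 : k ≠ 4) :
    3 * F.Sw (fun v => if v = 0 ∨ v = 4 then 1 else 0) + 6 * F.NkkForeign k < 6 * F.Nabk k := by
  by_contra h
  have := F.ZH_nonneg_of_petal_spectator_criterion k hk0 hk4 (not_lt.1 h)
  linarith

end Sunflower

end Summit.CriticalPhenomena.PercolationContinuityZ3.Theorems.SunflowerPartition
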